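import Summits.Ventures.PercRepro.RankLevelSetCoreFiveTwentyNine
import Summits.Ventures.PercRepro.RankLevelSetCoreSixFiftyTwo
import Summits.Ventures.PercRepro.RankLevelSetPlaneTenPrime

/-!
# PercRepro — THE `e`-FREE CORE AT LEVEL `6`, EVERY CORANK `≥ 51`, EVERY RANK `p ≥ 41` (p8 g3, S3)

`proofs/SUBCLAIM-S3-p8.md` §3h. `RankLevelSetCoreSixFiftyTwo` closes the corank-`≥ 51` cells of level `6` from
`p ≥ 52` on the flat bound `f(6) ≤ 43` with the regime-II key decided at `n = 2p`. Two sharpenings, no new counting: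

* the flat bound is the tree's `f(6) ≤ 39` (`ncard_le_thirtynine_of_eRk_le_six_of_free`, mine-4's
  RankLevelSetPlaneTenPrime), so the `U`-count is `C(n, 6)·2^{33}` in place of `C(n, 6)·2^{37}`;
* in these cells `n = |E| ≥ p + 51`, which is `> 2p` for `p ≤ 50`, so the regime-II key
  `2^{p+6}·2^{33}·C(n, 6) ≤ C(p+6, p)·C(n, p − 1)` is only needed from `n₀ = p + 51` — where it is a numeral for
  `41 ≤ p ≤ 51` (`key_six_thirtynine_of_le_51`, decided) and propagates upward by `regimeII_key_of_base`
  (`C(n, p − 1)/C(n, 6)` is non-decreasing in `n`).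

**`core_corank_of_bound_key_from`** is the regime-II half of p7's `core_all_corank_of_bound_key` with the key
hypothesis from an arbitrary `n₀ ≤ |E|` (the proof is that half, line for line); the flat-bound clause
`B + 2 ≤ p` of `choose_le_midCount_of_bound` (every `(p − 1)`-subset has rank `> 6`) is what sets `p ≥ 41`.
**`c025_core_six_thirtynine_fortyone`** = the cells `(p, d ≥ 51)` for every `p ≥ 41` (`p ≥ 52` by the older
theorem). Axioms: standard.
-/

open scoped Matroid

namespace PercRepro

namespace ThmN

open Set

variable {α : Type}

/-- **Regime II of THEOREM C∞ with the key from an arbitrary `n₀`**: for a rank-`p` `e`-free core on `n ≥ n₀`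
elements whose rank-`≤ q` sets have `≤ B` points (`B + 2 ≤ p`), the key
`2^{p+q}·2^{B−q}·C(n, q) ≤ C(p+q, p)·C(n, p − 1)` for every `n ≥ n₀` gives `RLS M p q`
(`U ≤ C(n, q)·2^{B−q}`, `Y ≥ C(n, p − 1)`, `Φ ≤ 2^{p+q}/C(p+q, p)`; the rank of `M` is not used). -/
theorem core_corank_of_bound_key_from (q B n₀ : ℕ) (M : Matroid α) [M.Finite] (p : ℕ) (hpB : B + 2 ≤ p)
    (hkey : ∀ n, n₀ ≤ n → 2 ^ (p + q) * 2 ^ (B - q) * n.choose q ≤ (p + q).choose p * n.choose (p - 1))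
    (hbig : n₀ ≤ M.E.ncard)
    (hfree : ∀ e ∈ M.E, ∃ A ⊆ M.E \ {e}, e ∉ M.closure A ∧ e ∉ M.closure ((M.E \ {e}) \ A))
    (hBq : ∀ X ⊆ M.E, M.eRk X ≤ q → X.ncard ≤ B) : RLS M p q := by
  classical
  set n := M.E.ncard with hn_def
  have hEcard : M.ground_finite.toFinset.card = n := by
    rw [hn_def, Set.ncard_eq_toFinset_card _ M.ground_finite]
  have hU : Matroid.topCount M p q ≤ n.choose q * 2 ^ (B - q) := by
    calc Matroid.topCount M p q ≤ Matroid.levelCount M q := Matroid.topCount_le_levelCount_bot p q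
      _ = {X : Set α | X ⊆ M.E ∧ M.eRk X = q}.ncard := rfl
      _ ≤ n.choose q * 2 ^ (B - q) := by rw [← hEcard]; exact ncard_eRk_eq_le_choose_mul_of_bound M q B hBq
  have hΦ := phiK_le_two_pow_div p q
  have hU0 : (0 : ℚ) ≤ (Matroid.topCount M p q : ℚ) := by positivity
  rw [RLS_iff]
  have hY := choose_le_midCount_of_bound M hfree hBq hpB
  rw [hEcard] at hY
  have hkey := hkey n hbig
  have hYq : (n.choose (p - 1) : ℚ) ≤ (Matroid.midCount M p q : ℚ) := by exact_mod_cast hY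
  have hUq' : (Matroid.topCount M p q : ℚ) ≤ (n.choose q : ℚ) * ((2 ^ (B - q) : ℕ) : ℚ) := by
    exact_mod_cast hU
  exact coreSharp_arith_II hΦ hU0 hUq' hkey hYq

/-- The regime-II key at `q = 6`, `B = 39`, `n = p + 51`, for `41 ≤ p ≤ 51` — eleven numerals, decided. -/
theorem key_six_thirtynine_of_le_51 (p : ℕ) (hp : 41 ≤ p) (hp' : p ≤ 51) :
    2 ^ (p + 6) * 2 ^ (39 - 6) * (p + 51).choose 6 ≤ (p + 6).choose p * (p + 51).choose (p - 1) := by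
  interval_cases p <;> decide

/-- **The `e`-free core at level `6`, every corank `≥ 51`, every rank `p ≥ 41`** (`p ≥ 52`: `RankLevelSetCoreSixFiftyTwo`;
`41 ≤ p ≤ 51`: the flat bound `f(6) ≤ 39` and the key decided at `n₀ = p + 51 ≤ |E|`). -/
theorem c025_core_six_thirtynine_fortyone (M : Matroid α) [M.Finite] (p : ℕ) (hp : 41 ≤ p)
    (hR : M.eRank = (p : ℕ∞)) (hbig : p + 50 < M.E.ncard)
    (hfree : ∀ e ∈ M.E, ∃ A ⊆ M.E \ {e}, e ∉ M.closure A ∧ e ∉ M.closure ((M.E \ {e}) \ A)) : RLS M p 6 := by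
  rcases Nat.lt_or_ge p 52 with hlt | hge
  · have hBq : ∀ X ⊆ M.E, M.eRk X ≤ 6 → X.ncard ≤ 39 :=
      fun X hX hr => ncard_le_thirtynine_of_eRk_le_six_of_free M hfree hX hr
    refine core_corank_of_bound_key_from 6 39 (p + 51) M p (by omega) ?_ (by omega) hfree hBq
    exact regimeII_key_of_base p 6 (2 ^ (39 - 6)) ((p + 6).choose p) (p + 51) (by omega) (by omega) (by omega)
      (key_six_thirtynine_of_le_51 p hp (by omega))
  · exact c025_core_six_fortythree_fiftytwo M p hge hR hbig hfree

end ThmN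

end PercRepro
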